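import Literature.NumberTheory.LFunctions.SelbergDelangeRieszExpansion
import Literature.NumberTheory.LFunctions.SelbergDelangeOmegaEulerProduct
import HarnessLib

/-!
# Proof of the Selberg–Delange law for `z^{Ω(n)}` (Montgomery–Vaughan 2007, Theorem 7.18 with (7.60))

Topic `Literature/NumberTheory/LFunctions`. Everything here is PROVED; the file discharges the named
fact `Literature.NumberTheory.LFunctions.MontgomeryVaughan2007_thm_7_18_Omega` of
`SelbergDelangeOmega.lean`:

> for every `R < 2` there is `C` with
> `|Σ_{n ≤ x} z^{Ω(n)} − F(1,z) Γ(z)⁻¹ x (log x)^{z−1}| ≤ C x (log x)^{Re z − 2}` for all `x ≥ 2`, `|z| ≤ R`.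

The proof (MV §7.4, pp. 177–179, in the arrangement of Tenenbaum II.5 §§5.3–5.4):

1. (`SelbergDelangeOmegaEulerProduct.lean`) `Σ z^{Ω(n)} n^{-s} = ζ(s)^z F(s,z)` with `F(·,z)`
   holomorphic and bounded on `σ > σ₀(R)`, `σ₀(R) < 1`, uniformly in `|z| ≤ R < 2`, and the
   non-negative majorant `R^{Ω(n)}`; this is the engine's `SelbergDelange.RieszData`
   (`rieszData_bigOmega`).
2. (`SelbergDelangeRieszExpansion.lean`) the contour argument gives, for the RIESZ MEANS
   `A₁(y) = Σ_{n ≤ y} z^{Ω(n)} (y − n)` and `B₁(y) = Σ_{n ≤ y} R^{Ω(n)} (y − n)`, expansions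
   `y² Σ_{k<N} c_k(z) Γ(z−k)⁻¹ (log y)^{z−1−k} + O(y² (log y)^{Re z−1−N})` with `c₀ = F(1,z)/2`.
3. **De-smoothing** (Tenenbaum II.5 §5.4; here `h = x (log x)^{−2R−1}`):
   `A(x) = (A₁(x+h) − A₁(x))/h + O(B(x+h) − B(x))`, the difference quotient of the smooth expansion
   is its derivative `F(1,z)Γ(z)⁻¹ x(log x)^{z−1} + O(x (log x)^{Re z−2})` up to `O(h (log x)^{R−1})`
   (two mean-value steps on `y ↦ y²(log y)^w`), and `B(x+h) − B(x)` is controlled by the second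
   difference of `B₁` (monotonicity of `B`, tree `RieszMean.sub_mul_sum_le_sub` /
   `sub_le_sub_mul_sum`) and hence by the same expansion for the majorant.
4. Bounded `x` (`2 ≤ x ≤ X₁`) are absorbed into the constant.

## References

* [MontgomeryVaughan2007] H. L. Montgomery, R. C. Vaughan, *Multiplicative Number Theory I*,
  CUP 2007, §7.4, Theorems 7.17–7.18 and (7.60), pp. 177–179.
* [Tenenbaum2015] G. Tenenbaum, *Introduction to analytic and probabilistic number theory*, 3rd
  ed., AMS GSM 163, II.5 §§5.3–5.4 (Theorem II.5.2), II.6 Theorem 6.1 (`z^{Ω(n)}`).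
* [Selberg1954] A. Selberg, *Note on a paper by L. G. Sathe*, J. Indian Math. Soc. 18 (1954) 83–87.
-/

noncomputable section

open Complex Set MeasureTheory Filter Topology Metric Finset
open scoped Real Nat

namespace Literature.NumberTheory.LFunctions

namespace SelbergDelangeOmega

open SelbergDelange
open scoped ArithmeticFunction.Omega

/-! ### Calculus of `φ_w(y) = y² (log y)^w` -/

/-- The complex logarithm-power `ℓ(y)^w`, `ℓ(y) = log y` as a complex number. [folklore] -/
def clog (y : ℝ) : ℂ := ((Real.log y : ℝ) : ℂ)

/-- `φ_w(y) = y² (log y)^w`. [folklore] -/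
def phi (w : ℂ) (y : ℝ) : ℂ := (y : ℂ) ^ 2 * clog y ^ w

/-- `φ_w'(y) = 2y (log y)^w + w y (log y)^{w−1}`. [folklore] -/
def phi' (w : ℂ) (y : ℝ) : ℂ := 2 * (y : ℂ) * clog y ^ w + w * (y : ℂ) * clog y ^ (w - 1)

/-- `φ_w''(y) = 2 (log y)^w + 3w (log y)^{w−1} + w(w−1) (log y)^{w−2}`. [folklore] -/
def phi'' (w : ℂ) (y : ℝ) : ℂ :=
  2 * clog y ^ w + 3 * w * clog y ^ (w - 1) + w * (w - 1) * clog y ^ (w - 2)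

/-- `d/dy log y = 1/y` as a complex-valued function (`y ≠ 0`). [folklore] -/
theorem hasDerivAt_clog {y : ℝ} (hy : y ≠ 0) : HasDerivAt clog ((y⁻¹ : ℝ) : ℂ) y :=
  (Real.hasDerivAt_log hy).ofReal_comp

/-- For `y > 1`, `log y` is a positive real, in the slit plane, nonzero. [folklore] -/
theorem clog_mem_slitPlane {y : ℝ} (hy : 1 < y) : clog y ∈ slitPlane ∧ clog y ≠ 0 := by
  have h := Real.log_pos hy
  refine ⟨Or.inl (by simpa [clog] using h), ?_⟩
  simp only [clog, ne_eq, ofReal_eq_zero]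
  exact h.ne'

/-- `d/dy (log y)^w = w (log y)^{w−1} / y` for `y > 1`. [folklore] -/
theorem hasDerivAt_clog_cpow (w : ℂ) {y : ℝ} (hy : 1 < y) :
    HasDerivAt (fun y ↦ clog y ^ w) (w * clog y ^ (w - 1) * ((y⁻¹ : ℝ) : ℂ)) y := by
  have hy0 : y ≠ 0 := by positivity
  exact (Complex.hasStrictDerivAt_cpow_const (clog_mem_slitPlane hy).1).hasDerivAt.comp y
    (hasDerivAt_clog hy0)

/-- `d/dy y = 1` as a complex-valued function. [folklore] -/
theorem hasDerivAt_ofReal' (y : ℝ) : HasDerivAt (fun y : ℝ ↦ (y : ℂ)) 1 y := by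
  simpa using (hasDerivAt_id y).ofReal_comp

/-- `d/dy y² = 2y` as a complex-valued function. [folklore] -/
theorem hasDerivAt_ofReal_sq (y : ℝ) : HasDerivAt (fun y : ℝ ↦ (y : ℂ) ^ 2) (2 * (y : ℂ)) y := by
  have h := (hasDerivAt_ofReal' y).mul (hasDerivAt_ofReal' y)
  have e : (fun y : ℝ ↦ (y : ℂ) ^ 2) = fun y : ℝ ↦ (y : ℂ) * (y : ℂ) := funext fun y ↦ sq _
  rw [e, show (2 : ℂ) * y = 1 * y + y * 1 by ring]
  exact h

/-- **`φ_w' ` is the derivative of `φ_w`** for `y > 1`. [folklore] -/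
theorem hasDerivAt_phi (w : ℂ) {y : ℝ} (hy : 1 < y) : HasDerivAt (phi w) (phi' w y) y := by
  have hy0 : (y : ℂ) ≠ 0 := ofReal_ne_zero.2 (by positivity)
  have h := (hasDerivAt_ofReal_sq y).mul (hasDerivAt_clog_cpow w hy)
  have e : 2 * (y : ℂ) * clog y ^ w + (y : ℂ) ^ 2 * (w * clog y ^ (w - 1) * ((y⁻¹ : ℝ) : ℂ)) =
      phi' w y := by
    rw [phi', ofReal_inv]; field_simp
  rw [← e]
  exact h

/-- **`φ_w''` is the derivative of `φ_w'`** for `y > 1`. [folklore] -/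
theorem hasDerivAt_phi' (w : ℂ) {y : ℝ} (hy : 1 < y) : HasDerivAt (phi' w) (phi'' w y) y := by
  have hy0 : (y : ℂ) ≠ 0 := ofReal_ne_zero.2 (by positivity)
  have hℓ0 := (clog_mem_slitPlane hy).2
  have h1 := ((hasDerivAt_ofReal' y).const_mul (2 : ℂ)).mul (hasDerivAt_clog_cpow w hy)
  have h2 := ((hasDerivAt_ofReal' y).const_mul w).mul (hasDerivAt_clog_cpow (w - 1) hy)
  have h := h1.add h2
  have e : 2 * 1 * clog y ^ w + 2 * (y : ℂ) * (w * clog y ^ (w - 1) * ((y⁻¹ : ℝ) : ℂ)) +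
      (w * 1 * clog y ^ (w - 1) + w * (y : ℂ) * ((w - 1) * clog y ^ (w - 1 - 1) * ((y⁻¹ : ℝ) : ℂ))) =
      phi'' w y := by
    rw [phi'', ofReal_inv, show w - 1 - 1 = w - 2 by ring]
    field_simp
    ring
  rw [← e]
  exact h

/-- `‖(log y)^w‖ = (log y)^{Re w}` for `y > 1`. [folklore] -/
theorem norm_clog_cpow (w : ℂ) {y : ℝ} (hy : 1 < y) : ‖clog y ^ w‖ = Real.log y ^ w.re := by
  rw [clog, norm_cpow_eq_rpow_re_of_pos (Real.log_pos hy)]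

/-- From `e ≤ y`: `1 < y` and `1 ≤ log y`. [folklore] -/
theorem one_lt_of_exp_le {y : ℝ} (hy : Real.exp 1 ≤ y) : 1 < y ∧ 1 ≤ Real.log y := by
  have h1 : 1 < y := lt_of_lt_of_le (by linarith [Real.add_one_le_exp (1:ℝ)]) hy
  refine ⟨h1, ?_⟩
  rw [← Real.log_exp 1]
  exact Real.log_le_log (Real.exp_pos 1) hy

/-- For `y ≥ e` and `Re w' ≤ e'`: `‖(log y)^{w'}‖ ≤ (log y)^{e'}`. [folklore] -/
theorem norm_clog_cpow_le {w' : ℂ} {e y : ℝ} (hy : Real.exp 1 ≤ y) (hw : w'.re ≤ e) :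
    ‖clog y ^ w'‖ ≤ Real.log y ^ e := by
  obtain ⟨hy1, hlog⟩ := one_lt_of_exp_le hy
  rw [norm_clog_cpow w' hy1]
  exact Real.rpow_le_rpow_of_exponent_le hlog hw

/-- **Bound for `φ_w'`**: `‖φ_w'(y)‖ ≤ (2 + ‖w‖) y (log y)^{Re w}` for `y ≥ e`. [folklore] -/
theorem norm_phi'_le (w : ℂ) {y : ℝ} (hy : Real.exp 1 ≤ y) :
    ‖phi' w y‖ ≤ (2 + ‖w‖) * y * Real.log y ^ w.re := by
  obtain ⟨hy1, hlog⟩ := one_lt_of_exp_le hy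
  have hy0 : 0 ≤ y := by linarith
  have h1 : ‖clog y ^ w‖ ≤ Real.log y ^ w.re := norm_clog_cpow_le hy le_rfl
  have h2 : ‖clog y ^ (w - 1)‖ ≤ Real.log y ^ w.re := norm_clog_cpow_le hy (by simp)
  rw [phi']
  calc ‖2 * (y : ℂ) * clog y ^ w + w * (y : ℂ) * clog y ^ (w - 1)‖
      ≤ ‖2 * (y : ℂ) * clog y ^ w‖ + ‖w * (y : ℂ) * clog y ^ (w - 1)‖ := norm_add_le _ _
    _ = 2 * y * ‖clog y ^ w‖ + ‖w‖ * y * ‖clog y ^ (w - 1)‖ := by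
        simp only [norm_mul, Complex.norm_real, Real.norm_of_nonneg hy0, Complex.norm_two]
    _ ≤ 2 * y * Real.log y ^ w.re + ‖w‖ * y * Real.log y ^ w.re := by gcongr
    _ = (2 + ‖w‖) * y * Real.log y ^ w.re := by ring

/-- **Bound for `φ_w''`**: `‖φ_w''(y)‖ ≤ (2 + 3‖w‖ + ‖w‖(‖w‖ + 1)) (log y)^{Re w}` for `y ≥ e`.
[folklore] -/
theorem norm_phi''_le (w : ℂ) {y : ℝ} (hy : Real.exp 1 ≤ y) :
    ‖phi'' w y‖ ≤ (2 + 3 * ‖w‖ + ‖w‖ * (‖w‖ + 1)) * Real.log y ^ w.re := by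
  have h1 : ‖clog y ^ w‖ ≤ Real.log y ^ w.re := norm_clog_cpow_le hy le_rfl
  have h2 : ‖clog y ^ (w - 1)‖ ≤ Real.log y ^ w.re := norm_clog_cpow_le hy (by simp)
  have h3 : ‖clog y ^ (w - 2)‖ ≤ Real.log y ^ w.re := norm_clog_cpow_le hy (by simp)
  have hw1 : ‖w - 1‖ ≤ ‖w‖ + 1 := by
    calc ‖w - 1‖ ≤ ‖w‖ + ‖(1 : ℂ)‖ := norm_sub_le _ _
      _ = ‖w‖ + 1 := by rw [norm_one]
  rw [phi'']
  calc ‖2 * clog y ^ w + 3 * w * clog y ^ (w - 1) + w * (w - 1) * clog y ^ (w - 2)‖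
      ≤ ‖2 * clog y ^ w‖ + ‖3 * w * clog y ^ (w - 1)‖ + ‖w * (w - 1) * clog y ^ (w - 2)‖ :=
        norm_add₃_le
    _ = 2 * ‖clog y ^ w‖ + 3 * ‖w‖ * ‖clog y ^ (w - 1)‖ + ‖w‖ * ‖w - 1‖ * ‖clog y ^ (w - 2)‖ := by
        simp only [norm_mul, Complex.norm_ofNat]
    _ ≤ 2 * Real.log y ^ w.re + 3 * ‖w‖ * Real.log y ^ w.re +
        ‖w‖ * (‖w‖ + 1) * Real.log y ^ w.re := by gcongr
    _ = (2 + 3 * ‖w‖ + ‖w‖ * (‖w‖ + 1)) * Real.log y ^ w.re := by ring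

/-! ### Mean value steps -/

/-- **First-order step**: if `‖f''‖ ≤ S` on `[x, x + h]` (`h ≥ 0`), then
`‖f(x+h) − f(x) − h f'(x)‖ ≤ h² S`. [folklore] -/
theorem norm_sub_sub_mul_le {f f' f'' : ℝ → ℂ} {x h S : ℝ} (hh : 0 ≤ h)
    (hf : ∀ t ∈ Icc x (x + h), HasDerivAt f (f' t) t)
    (hf' : ∀ t ∈ Icc x (x + h), HasDerivAt f' (f'' t) t)
    (hS : ∀ t ∈ Icc x (x + h), ‖f'' t‖ ≤ S) :
    ‖f (x + h) - f x - h * f' x‖ ≤ h ^ 2 * S := by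
  -- `‖f'(t) − f'(x)‖ ≤ S (t − x) ≤ S h`
  have h1 : ∀ t ∈ Icc x (x + h), ‖f' t - f' x‖ ≤ S * h := by
    intro t ht
    have := norm_image_sub_le_of_norm_deriv_le_segment' (f := f') (f' := f'')
      (fun u hu ↦ (hf' u hu).hasDerivWithinAt) (fun u hu ↦ hS u (Ico_subset_Icc_self hu)) t ht
    refine this.trans ?_
    have hS0 : 0 ≤ S := (norm_nonneg _).trans (hS x ⟨le_rfl, by linarith⟩)
    exact mul_le_mul_of_nonneg_left (by linarith [ht.2]) hS0
  -- apply the mean value inequality to `F(t) = f(t) − t f'(x)`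
  have hF : ∀ t ∈ Icc x (x + h), HasDerivWithinAt (fun t ↦ f t - (t : ℂ) * f' x) (f' t - f' x)
      (Icc x (x + h)) t := by
    intro t ht
    have h2 : HasDerivAt (fun t : ℝ ↦ (t : ℂ) * f' x) (f' x) t := by
      simpa using (hasDerivAt_ofReal' t).mul_const (f' x)
    exact ((hf t ht).sub h2).hasDerivWithinAt
  have h3 := norm_image_sub_le_of_norm_deriv_le_segment' hF
    (fun u hu ↦ h1 u (Ico_subset_Icc_self hu)) (x + h) ⟨by linarith, le_rfl⟩
  have e : (f (x + h) - ((x + h : ℝ) : ℂ) * f' x) - (f x - (x : ℂ) * f' x) =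
      f (x + h) - f x - h * f' x := by
    push_cast; ring
  rw [e, show x + h - x = h by ring] at h3
  calc ‖f (x + h) - f x - h * f' x‖ ≤ S * h * h := h3
    _ = h ^ 2 * S := by ring

/-- **Second-difference step**: if `‖g''‖ ≤ S` on `[x − h, x + 2h]` (`h ≥ 0`), then
`‖g(x+2h) − g(x+h) − g(x) + g(x−h)‖ ≤ 2 h² S`. [folklore] -/
theorem norm_second_difference_le {g g' g'' : ℝ → ℂ} {x h S : ℝ} (hh : 0 ≤ h)
    (hg : ∀ t ∈ Icc (x - h) (x + 2 * h), HasDerivAt g (g' t) t)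
    (hg' : ∀ t ∈ Icc (x - h) (x + 2 * h), HasDerivAt g' (g'' t) t)
    (hS : ∀ t ∈ Icc (x - h) (x + 2 * h), ‖g'' t‖ ≤ S) :
    ‖g (x + 2 * h) - g (x + h) - g x + g (x - h)‖ ≤ 2 * h ^ 2 * S := by
  have hS0 : 0 ≤ S := (norm_nonneg _).trans (hS x ⟨by linarith, by linarith⟩)
  -- `Ψ(t) = g(t + h) − g(t)` on `[x − h, x + h]`, `Ψ' = g'(t+h) − g'(t)`, `‖Ψ'‖ ≤ h S`
  set Ψ : ℝ → ℂ := fun t ↦ g (t + h) - g t with hΨ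
  have hΨ' : ∀ t ∈ Icc (x - h) (x + h),
      HasDerivWithinAt Ψ (g' (t + h) - g' t) (Icc (x - h) (x + h)) t := by
    intro t ht
    have h1 : HasDerivAt (fun t ↦ g (t + h)) (g' (t + h)) t :=
      (hg (t + h) ⟨by linarith [ht.1], by linarith [ht.2]⟩).comp_add_const t h
    exact (h1.sub (hg t ⟨ht.1, by linarith [ht.2]⟩)).hasDerivWithinAt
  have hbd : ∀ t ∈ Ico (x - h) (x + h), ‖g' (t + h) - g' t‖ ≤ h * S := by
    intro t ht
    have := norm_image_sub_le_of_norm_deriv_le_segment' (f := g') (f' := g'') (a := t) (b := t + h)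
      (fun u hu ↦ (hg' u ⟨by linarith [hu.1, ht.1], by linarith [hu.2, ht.2]⟩).hasDerivWithinAt)
      (fun u hu ↦ hS u ⟨by linarith [hu.1, ht.1], by linarith [hu.2, ht.2]⟩) (t + h)
      ⟨by linarith, le_rfl⟩
    rw [show t + h - t = h by ring] at this
    linarith [this]
  have h3 := norm_image_sub_le_of_norm_deriv_le_segment' hΨ' hbd (x + h) ⟨by linarith, le_rfl⟩
  have e : Ψ (x + h) - Ψ (x - h) = g (x + 2 * h) - g (x + h) - g x + g (x - h) := by
    simp only [hΨ]; rw [show x + h + h = x + 2 * h by ring, show x - h + h = x by ring]; ring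
  rw [e, show x + h - (x - h) = 2 * h by ring] at h3
  calc _ ≤ h * S * (2 * h) := h3
    _ = 2 * h ^ 2 * S := by ring

/-! ### The data of the engine for `z^{Ω(n)}` -/

/-- **`z^{Ω(n)}` satisfies the hypotheses of the engine**: for `0 ≤ R < 2`, with `σ₁ = σ₀(R)` and a
suitable `B`, every `‖z‖ ≤ R` gives `RieszData R (sigma0 R) B z (bigOmegaCoeff z) (bigOmegaF · z)`.
[cite: MontgomeryVaughan2007, §7.4 (7.60)] -/
theorem rieszData_bigOmega {R : ℝ} (hR0 : 0 ≤ R) (hR : R < 2) :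
    ∃ B : ℝ, 0 < B ∧ ∀ z : ℂ, ‖z‖ ≤ R →
      RieszData R (sigma0 R) B z (bigOmegaCoeff z) (fun s ↦ bigOmegaF s z) := by
  obtain ⟨B₀, hB₀, hbd⟩ := exists_bound_bigOmegaF hR
  refine ⟨B₀ * 2 ^ R + B₀, by positivity, fun z hz ↦ ?_⟩
  have hz2 : ‖z‖ < 2 := hz.trans_lt hR
  refine ⟨hz, differentiableOn_bigOmegaF hR hz, fun s hs ↦ ?_, fun σ hσ ↦ ?_, fun s hs ↦ ?_,
    fun σ hσ hσ2 ↦ ?_⟩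
  · have := hbd s z hs.le hz
    have : 0 ≤ B₀ * 2 ^ R := by positivity
    linarith
  · exact LSeriesSummable_bigOmegaCoeff hz2 (by simpa using hσ)
  · rw [LSeries_bigOmegaCoeff_eq hz2 hs, zetaPow_eq_exp_eulerLogZeta z hs, mul_comm]
  · have hσ' : 1 < ((σ : ℂ)).re := by simpa using hσ
    have h1 := tsum_norm_term_le_norm_LSeries_majorant hR hz (s := (σ : ℂ)) hσ'
    simp only [ofReal_re] at h1
    have h2 := norm_LSeries_majorant_le hR0 hR (fun s z hs hz ↦ hbd s z hs hz) hσ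
    have hσ1 : 0 < σ - 1 := by linarith
    calc ∑' n, ‖LSeries.term (bigOmegaCoeff z) σ n‖ ≤ ‖LSeries (bigOmegaCoeff R) σ‖ := h1
      _ ≤ B₀ * (σ / (σ - 1)) ^ R := h2
      _ ≤ (B₀ * 2 ^ R + B₀) / (σ - 1) ^ R := by
          rw [Real.div_rpow (by linarith) hσ1.le, mul_div_assoc']
          refine (div_le_div_of_nonneg_right ?_ (Real.rpow_pos_of_pos hσ1 R).le)
          have : σ ^ R ≤ 2 ^ R := Real.rpow_le_rpow (by linarith) hσ2 hR0
          nlinarith [Real.rpow_nonneg (by linarith : (0:ℝ) ≤ σ) R]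

/-! ### Comparison of powers of `log y` for `y ∈ [x/2, 2x]` -/

/-- For `log x ≥ 2 log 2`, `x/2 ≤ y ≤ 2x` and `|e| ≤ P`: `(log y)^e ≤ 2^P (log x)^e`. [folklore] -/
theorem rpow_log_le {x y e P : ℝ} (hx : 0 < x) (hℓ : 2 * Real.log 2 ≤ Real.log x)
    (hy : x / 2 ≤ y ∧ y ≤ 2 * x) (he : |e| ≤ P) :
    Real.log y ^ e ≤ 2 ^ P * Real.log x ^ e := by
  set ℓ := Real.log x with hℓdef
  have hlog2 : 0 < Real.log 2 := Real.log_pos one_lt_two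
  have hℓ0 : 0 < ℓ := by linarith
  have hy0 : 0 < y := by linarith [hy.1]
  have hly1 : ℓ - Real.log 2 ≤ Real.log y := by
    have : Real.log (x / 2) = ℓ - Real.log 2 := by rw [Real.log_div hx.ne' two_ne_zero]
    rw [← this]; exact Real.log_le_log (by positivity) hy.1
  have hly2 : Real.log y ≤ ℓ + Real.log 2 := by
    have : Real.log (2 * x) = ℓ + Real.log 2 := by rw [Real.log_mul two_ne_zero hx.ne']; ring
    rw [← this]; exact Real.log_le_log hy0 hy.2
  have hlypos : 0 < Real.log y := by linarith
  have hP : 0 ≤ P := (abs_nonneg e).trans he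
  have hℓe : 0 < ℓ ^ e := Real.rpow_pos_of_pos hℓ0 e
  rcases le_or_gt 0 e with he0 | he0
  · calc Real.log y ^ e ≤ (2 * ℓ) ^ e := Real.rpow_le_rpow hlypos.le (by linarith) he0
      _ = 2 ^ e * ℓ ^ e := Real.mul_rpow zero_le_two hℓ0.le
      _ ≤ 2 ^ P * ℓ ^ e := by
          refine mul_le_mul_of_nonneg_right ?_ hℓe.le
          exact Real.rpow_le_rpow_of_exponent_le one_le_two ((le_abs_self e).trans he)
  · calc Real.log y ^ e ≤ (ℓ / 2) ^ e :=
          Real.rpow_le_rpow_of_nonpos (by positivity) (by linarith) he0.le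
      _ = 2 ^ (-e) * ℓ ^ e := by
          rw [Real.div_rpow hℓ0.le zero_le_two, Real.rpow_neg zero_le_two, div_eq_mul_inv, mul_comm]
      _ ≤ 2 ^ P * ℓ ^ e := by
          refine mul_le_mul_of_nonneg_right ?_ hℓe.le
          exact Real.rpow_le_rpow_of_exponent_le one_le_two ((neg_le_abs e).trans he)

/-! ### Riesz means and summatory functions -/

/-- The Riesz mean `A₁(y) = Σ_{n ≤ y} a(n)(y − n)`. [cite: MontgomeryVaughan2007, §5.1 (5.19)] -/
def rieszMeanC (a : ℕ → ℂ) (y : ℝ) : ℂ := ∑ n ∈ Finset.Ioc 0 ⌊y⌋₊, a n * ((y : ℂ) - n)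

/-- The summatory function `A(y) = Σ_{n ≤ y} a(n)`. [folklore] -/
def summatory (a : ℕ → ℂ) (y : ℝ) : ℂ := ∑ n ∈ Finset.Ioc 0 ⌊y⌋₊, a n

/-- **Splitting the Riesz mean at `x ≤ y`**:
`A₁(y) − A₁(x) = (y − x) A(x) + Σ_{x < n ≤ y} a(n)(y − n)`. [folklore] -/
theorem rieszMeanC_sub_eq (a : ℕ → ℂ) {x y : ℝ} (hxy : x ≤ y) :
    rieszMeanC a y - rieszMeanC a x =
      ((y - x : ℝ) : ℂ) * summatory a x + ∑ n ∈ Finset.Ioc ⌊x⌋₊ ⌊y⌋₊, a n * ((y : ℂ) - n) := by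
  rw [rieszMeanC, rieszMeanC, summatory,
    ← Finset.sum_Ioc_consecutive _ (Nat.zero_le _) (Nat.floor_le_floor hxy), Finset.mul_sum]
  have : ∑ n ∈ Finset.Ioc 0 ⌊x⌋₊, a n * ((y : ℂ) - n) - ∑ n ∈ Finset.Ioc 0 ⌊x⌋₊, a n * ((x : ℂ) - n) =
      ∑ n ∈ Finset.Ioc 0 ⌊x⌋₊, ((y - x : ℝ) : ℂ) * a n := by
    rw [← Finset.sum_sub_distrib]
    refine Finset.sum_congr rfl fun n _ ↦ ?_
    push_cast; ring
  linear_combination this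

/-- **The short sum is small**: for `‖a‖ ≤ b` (`b ≥ 0`) and `0 ≤ x ≤ y`,
`‖A₁(y) − A₁(x) − (y − x) A(x)‖ ≤ (y − x)(B(y) − B(x))`, `B` the summatory function of `b`. [folklore] -/
theorem norm_rieszMeanC_sub_sub_le {a : ℕ → ℂ} {b : ℕ → ℝ} (hab : ∀ n, ‖a n‖ ≤ b n)
    {x y : ℝ} (hx : 0 ≤ x) (hxy : x ≤ y) :
    ‖rieszMeanC a y - rieszMeanC a x - ((y - x : ℝ) : ℂ) * summatory a x‖ ≤
      (y - x) * ((∑ n ∈ Finset.Ioc 0 ⌊y⌋₊, b n) - ∑ n ∈ Finset.Ioc 0 ⌊x⌋₊, b n) := by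
  rw [rieszMeanC_sub_eq a hxy, add_sub_cancel_left,
    ← Finset.sum_Ioc_consecutive _ (Nat.zero_le _) (Nat.floor_le_floor hxy), add_sub_cancel_left,
    Finset.mul_sum]
  refine (norm_sum_le _ _).trans (Finset.sum_le_sum fun n hn ↦ ?_)
  rw [Finset.mem_Ioc] at hn
  have hxn : x < n := by
    have := Nat.lt_of_floor_lt hn.1
    exact_mod_cast this
  have hny : (n : ℝ) ≤ y := (Nat.cast_le.2 hn.2).trans (Nat.floor_le (hx.trans hxy))
  rw [norm_mul, show ((y : ℂ) - n) = ((y - n : ℝ) : ℂ) by push_cast; ring, Complex.norm_real,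
    Real.norm_of_nonneg (by linarith), mul_comm]
  exact mul_le_mul (by linarith) (hab n) (norm_nonneg _) (by linarith)

/-- The Riesz mean of real coefficients is real: `A₁(b)(y) = (B₁(y) : ℂ)`. [folklore] -/
theorem rieszMeanC_ofReal (b : ℕ → ℝ) (y : ℝ) :
    rieszMeanC (fun n ↦ (b n : ℂ)) y = ((∑ n ∈ Finset.Ioc 0 ⌊y⌋₊, b n * (y - n) : ℝ) : ℂ) := by
  rw [rieszMeanC]; push_cast; rfl

/-- **Monotonicity bound**: for `b ≥ 0`, `0 ≤ h`, `0 ≤ x − h`,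
`B(x + h) − B(x) ≤ (B₁(x+2h) − B₁(x+h) − B₁(x) + B₁(x−h))/h` … in the multiplied-out form
`h (B(x+h) − B(x)) ≤ Re(A₁(b)(x+2h) − A₁(b)(x+h) − A₁(b)(x) + A₁(b)(x−h))`.
[cite: Tenenbaum2015, II.5 §5.4] -/
theorem mul_sub_summatory_le {b : ℕ → ℝ} (hb : ∀ n, 0 ≤ b n) {x h : ℝ} (hh : 0 ≤ h) (hxh : 0 ≤ x - h) :
    h * ((∑ n ∈ Finset.Ioc 0 ⌊x + h⌋₊, b n) - ∑ n ∈ Finset.Ioc 0 ⌊x⌋₊, b n) ≤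
      (rieszMeanC (fun n ↦ (b n : ℂ)) (x + 2 * h) - rieszMeanC (fun n ↦ (b n : ℂ)) (x + h) -
        rieszMeanC (fun n ↦ (b n : ℂ)) x + rieszMeanC (fun n ↦ (b n : ℂ)) (x - h)).re := by
  simp only [rieszMeanC_ofReal, sub_re, add_re, ofReal_re]
  have h1 := RieszMean.sub_mul_sum_le_sub hb (x := x + h) (y := x + 2 * h) (by linarith) (by linarith)
  have h2 := RieszMean.sub_le_sub_mul_sum hb (x := x - h) (y := x) (by linarith)
  rw [show x + 2 * h - (x + h) = h by ring] at h1
  rw [show x - (x - h) = h by ring] at h2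
  nlinarith

/-! ### The smooth expansion and its derivatives -/

/-- `f(y) = Σ_{k<N} c_k φ_{z−1−k}(y)`. [cite: MontgomeryVaughan2007, §7.4 Theorem 7.17] -/
def expansion (c : ℕ → ℂ) (z : ℂ) (N : ℕ) (y : ℝ) : ℂ :=
  ∑ k ∈ Finset.range N, c k * phi (z - 1 - k) y

/-- `f'(y)`. [folklore] -/
def expansion' (c : ℕ → ℂ) (z : ℂ) (N : ℕ) (y : ℝ) : ℂ :=
  ∑ k ∈ Finset.range N, c k * phi' (z - 1 - k) y

/-- `f''(y)`. [folklore] -/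
def expansion'' (c : ℕ → ℂ) (z : ℂ) (N : ℕ) (y : ℝ) : ℂ :=
  ∑ k ∈ Finset.range N, c k * phi'' (z - 1 - k) y

/-- `f' ` is the derivative of `f` (`y > 1`). [folklore] -/
theorem hasDerivAt_expansion (c : ℕ → ℂ) (z : ℂ) (N : ℕ) {y : ℝ} (hy : 1 < y) :
    HasDerivAt (expansion c z N) (expansion' c z N y) y := by
  unfold expansion expansion'
  exact HasDerivAt.fun_sum fun k _ ↦ (hasDerivAt_phi _ hy).const_mul _

/-- `f''` is the derivative of `f'` (`y > 1`). [folklore] -/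
theorem hasDerivAt_expansion' (c : ℕ → ℂ) (z : ℂ) (N : ℕ) {y : ℝ} (hy : 1 < y) :
    HasDerivAt (expansion' c z N) (expansion'' c z N y) y := by
  unfold expansion' expansion''
  exact HasDerivAt.fun_sum fun k _ ↦ (hasDerivAt_phi' _ hy).const_mul _

/-- The engine's main term is `f(x)`: `x² Σ_{k<N} coeff_k Γ(z−k)⁻¹ (log x)^{z−1−k} = f(x)` with
`c_k = coeff_k Γ(z−k)⁻¹`. [folklore] -/
theorem expansion_eq (cf : ℕ → ℂ) (z : ℂ) (N : ℕ) (x : ℝ) :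
    (x : ℂ) ^ 2 * ∑ k ∈ Finset.range N, cf k * (Complex.Gamma (z - k))⁻¹ *
        ((Real.log x : ℝ) : ℂ) ^ (z - 1 - k) =
      expansion (fun k ↦ cf k * (Complex.Gamma (z - k))⁻¹) z N x := by
  rw [expansion, Finset.mul_sum]
  refine Finset.sum_congr rfl fun k _ ↦ ?_
  rw [phi, clog]; ring

/-- **Bound for `f''`** on `y ≥ e` with `log y`-powers compared at `x`: if `‖c_k‖ ≤ D`, `‖z‖ ≤ R`,
then `‖f''(y)‖ ≤ N D (2 + 3P + P(P+1)) (log y)^{Re z − 1}`, `P = R + N + 1`. [folklore] -/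
theorem norm_expansion''_le {c : ℕ → ℂ} {z : ℂ} {N : ℕ} {D R : ℝ} (hc : ∀ k < N, ‖c k‖ ≤ D)
    (hz : ‖z‖ ≤ R) {y : ℝ} (hy : Real.exp 1 ≤ y) :
    ‖expansion'' c z N y‖ ≤
      N * (D * (2 + 3 * (R + N + 1) + (R + N + 1) * (R + N + 1 + 1))) * Real.log y ^ (z.re - 1) := by
  obtain ⟨hy1, hlog⟩ := one_lt_of_exp_le hy
  set P : ℝ := R + N + 1 with hP
  have hD : ∀ k < N, 0 ≤ D := fun k hk ↦ (norm_nonneg _).trans (hc k hk)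
  have hterm : ∀ k ∈ Finset.range N, ‖c k * phi'' (z - 1 - k) y‖ ≤
      D * (2 + 3 * P + P * (P + 1)) * Real.log y ^ (z.re - 1) := by
    intro k hk
    rw [Finset.mem_range] at hk
    have hw : ‖z - 1 - (k : ℂ)‖ ≤ P := by
      calc ‖z - 1 - (k : ℂ)‖ ≤ ‖z‖ + ‖(1 : ℂ)‖ + ‖(k : ℂ)‖ := norm_sub_le_of_le (norm_sub_le _ _) le_rfl
        _ ≤ R + 1 + N := by
            rw [norm_one, Complex.norm_natCast]
            have : (k : ℝ) ≤ N := by exact_mod_cast hk.le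
            linarith
        _ = P := by rw [hP]; ring
    have h1 := norm_phi''_le (z - 1 - k) hy
    have hre : (z - 1 - (k : ℂ)).re ≤ z.re - 1 := by simp
    have h2 : Real.log y ^ (z - 1 - (k : ℂ)).re ≤ Real.log y ^ (z.re - 1) :=
      Real.rpow_le_rpow_of_exponent_le hlog hre
    have hcoef : 2 + 3 * ‖z - 1 - (k : ℂ)‖ + ‖z - 1 - (k : ℂ)‖ * (‖z - 1 - (k : ℂ)‖ + 1) ≤
        2 + 3 * P + P * (P + 1) := by nlinarith [norm_nonneg (z - 1 - (k : ℂ))]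
    rw [norm_mul]
    calc ‖c k‖ * ‖phi'' (z - 1 - k) y‖
        ≤ D * ((2 + 3 * ‖z - 1 - (k : ℂ)‖ + ‖z - 1 - (k : ℂ)‖ * (‖z - 1 - (k : ℂ)‖ + 1)) *
            Real.log y ^ (z - 1 - (k : ℂ)).re) := mul_le_mul (hc k hk) h1 (norm_nonneg _) (hD k hk)
      _ ≤ D * ((2 + 3 * P + P * (P + 1)) * Real.log y ^ (z.re - 1)) := by
          refine mul_le_mul_of_nonneg_left ?_ (hD k hk)
          have hR : 0 ≤ R := (norm_nonneg _).trans hz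
          have hP0 : 0 ≤ P := by rw [hP]; positivity
          exact mul_le_mul hcoef h2 (Real.rpow_nonneg (by linarith) _) (by positivity)
      _ = _ := by ring
  calc ‖expansion'' c z N y‖ ≤ ∑ k ∈ Finset.range N, D * (2 + 3 * P + P * (P + 1)) * Real.log y ^ (z.re - 1) :=
        norm_sum_le_of_le _ hterm
    _ = _ := by rw [Finset.sum_const, Finset.card_range, nsmul_eq_mul]; ring

/-- **The derivative is the main term up to `O(x (log x)^{Re z − 2})`**:
`‖f'(x) − 2 c₀ x (log x)^{z−1}‖ ≤ D((R+1) + N(2 + (R+N+1))) x (log x)^{Re z−2}` for `x ≥ e`,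
`‖c_k‖ ≤ D`, `‖z‖ ≤ R`, `N ≥ 1`. [cite: MontgomeryVaughan2007, §7.4 Theorem 7.17] -/
theorem norm_expansion'_sub_le {c : ℕ → ℂ} {z : ℂ} {N : ℕ} {D R : ℝ} (hc : ∀ k < N, ‖c k‖ ≤ D)
    (hz : ‖z‖ ≤ R) (hN : 1 ≤ N) {x : ℝ} (hx : Real.exp 1 ≤ x) :
    ‖expansion' c z N x - 2 * c 0 * x * clog x ^ (z - 1)‖ ≤
      D * ((R + 1) + N * (2 + (R + N + 1))) * x * Real.log x ^ (z.re - 2) := by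
  obtain ⟨hx1, hlog⟩ := one_lt_of_exp_le hx
  have hx0 : 0 ≤ x := by linarith
  have hD : 0 ≤ D := (norm_nonneg _).trans (hc 0 (by omega))
  have hR : 0 ≤ R := (norm_nonneg _).trans hz
  have hlog0 : 0 ≤ Real.log x := by linarith
  have hsplit : expansion' c z N x =
      c 0 * phi' (z - 1) x + ∑ k ∈ Finset.Ico 1 N, c k * phi' (z - 1 - k) x := by
    rw [expansion', Finset.range_eq_Ico, Finset.sum_eq_sum_Ico_succ_bot (show 0 < N by omega)]
    simp
  have hmain0 : c 0 * phi' (z - 1) x - 2 * c 0 * x * clog x ^ (z - 1) =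
      c 0 * ((z - 1) * x * clog x ^ (z - 2)) := by
    rw [phi', show z - 1 - 1 = z - 2 by ring]; ring
  have e : expansion' c z N x - 2 * c 0 * x * clog x ^ (z - 1) =
      c 0 * ((z - 1) * x * clog x ^ (z - 2)) + ∑ k ∈ Finset.Ico 1 N, c k * phi' (z - 1 - k) x := by
    rw [hsplit, ← hmain0]; ring
  rw [e]
  -- the `k = 0` part
  have h0 : ‖c 0 * ((z - 1) * x * clog x ^ (z - 2))‖ ≤ D * (R + 1) * x * Real.log x ^ (z.re - 2) := by
    rw [norm_mul, norm_mul, norm_mul, Complex.norm_real, Real.norm_of_nonneg hx0,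
      norm_clog_cpow _ hx1]
    have hz1 : ‖z - 1‖ ≤ R + 1 := by
      calc ‖z - 1‖ ≤ ‖z‖ + ‖(1 : ℂ)‖ := norm_sub_le _ _
        _ ≤ R + 1 := by rw [norm_one]; linarith
    have hre : (z - 2).re = z.re - 2 := by simp
    rw [hre]
    have hpow : 0 ≤ Real.log x ^ (z.re - 2) := Real.rpow_nonneg hlog0 _
    calc ‖c 0‖ * (‖z - 1‖ * x * Real.log x ^ (z.re - 2))
        ≤ D * ((R + 1) * x * Real.log x ^ (z.re - 2)) :=
          mul_le_mul (hc 0 (by omega)) (by gcongr) (by positivity) hD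
      _ = _ := by ring
  -- the `k ≥ 1` part
  have hterm : ∀ k ∈ Finset.Ico 1 N, ‖c k * phi' (z - 1 - k) x‖ ≤
      D * (2 + (R + N + 1)) * x * Real.log x ^ (z.re - 2) := by
    intro k hk
    rw [Finset.mem_Ico] at hk
    have hk1 : (1 : ℝ) ≤ k := by exact_mod_cast hk.1
    have hkN : (k : ℝ) ≤ N := by exact_mod_cast hk.2.le
    have hw : ‖z - 1 - (k : ℂ)‖ ≤ R + N + 1 := by
      calc ‖z - 1 - (k : ℂ)‖ ≤ ‖z - 1‖ + ‖(k : ℂ)‖ := norm_sub_le _ _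
        _ ≤ (‖z‖ + ‖(1 : ℂ)‖) + ‖(k : ℂ)‖ := by gcongr; exact norm_sub_le _ _
        _ ≤ R + N + 1 := by rw [norm_one, Complex.norm_natCast]; linarith
    have h1 := norm_phi'_le (z - 1 - k) hx
    have hre : (z - 1 - (k : ℂ)).re ≤ z.re - 2 := by simp; linarith
    have h2 : Real.log x ^ (z - 1 - (k : ℂ)).re ≤ Real.log x ^ (z.re - 2) :=
      Real.rpow_le_rpow_of_exponent_le hlog hre
    rw [norm_mul]
    calc ‖c k‖ * ‖phi' (z - 1 - k) x‖
        ≤ D * ((2 + ‖z - 1 - (k : ℂ)‖) * x * Real.log x ^ (z - 1 - (k : ℂ)).re) :=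
          mul_le_mul (hc k hk.2) h1 (norm_nonneg _) hD
      _ ≤ D * ((2 + (R + N + 1)) * x * Real.log x ^ (z.re - 2)) := by
          refine mul_le_mul_of_nonneg_left ?_ hD
          exact mul_le_mul (mul_le_mul_of_nonneg_right (by linarith) hx0) h2
            (Real.rpow_nonneg hlog0 _) (by positivity)
      _ = _ := by ring
  have hrest : ‖∑ k ∈ Finset.Ico 1 N, c k * phi' (z - 1 - k) x‖ ≤
      N * (D * (2 + (R + N + 1)) * x * Real.log x ^ (z.re - 2)) := by
    have hpos : 0 ≤ D * (2 + (R + N + 1)) * x * Real.log x ^ (z.re - 2) := by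
      have : 0 ≤ Real.log x ^ (z.re - 2) := Real.rpow_nonneg hlog0 _
      positivity
    calc _ ≤ ∑ k ∈ Finset.Ico 1 N, D * (2 + (R + N + 1)) * x * Real.log x ^ (z.re - 2) :=
          norm_sum_le_of_le _ hterm
      _ = ((N - 1 : ℕ) : ℝ) * (D * (2 + (R + N + 1)) * x * Real.log x ^ (z.re - 2)) := by
          rw [Finset.sum_const, Nat.card_Ico, nsmul_eq_mul]
      _ ≤ N * (D * (2 + (R + N + 1)) * x * Real.log x ^ (z.re - 2)) := by
          refine mul_le_mul_of_nonneg_right ?_ hpos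
          exact_mod_cast Nat.sub_le N 1
  calc _ ≤ ‖c 0 * ((z - 1) * x * clog x ^ (z - 2))‖ + ‖∑ k ∈ Finset.Ico 1 N, c k * phi' (z - 1 - k) x‖ :=
        norm_add_le _ _
    _ ≤ D * (R + 1) * x * Real.log x ^ (z.re - 2) +
        N * (D * (2 + (R + N + 1)) * x * Real.log x ^ (z.re - 2)) := add_le_add h0 hrest
    _ = _ := by ring

/-! ### De-smoothing -/

/-- The constant of the de-smoothing step. [folklore] -/
def desmoothConst (C₁ D R : ℝ) (N : ℕ) : ℝ :=
  D * ((R + 1) + N * (2 + (R + N + 1))) +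
    2 ^ (R + N + 2) * (21 * C₁ + 3 * (N * (D * (2 + 3 * (R + N + 1) + (R + N + 1) * (R + N + 1 + 1)))))

set_option maxHeartbeats 800000 in
/-- **De-smoothing** (Tenenbaum II.5 §5.4; MV §7.4): let `‖a(n)‖ ≤ b(n)`, `b ≥ 0`, `‖z‖ ≤ R`,
`N ≥ 4R + 2`, and suppose the Riesz means of `a` and of `b` have the expansions
`‖A₁(y) − f_z(y)‖ ≤ C₁ y² (log y)^{Re z−1−N}`, `‖B₁(y) − f_R(y)‖ ≤ C₁ y² (log y)^{R−1−N}` for `y ≥ x₀`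
with coefficient bounds `‖c_k‖, ‖c^R_k‖ ≤ D`. Then for `x ≥ max(2x₀, e⁴)`,
`‖A(x) − 2c₀ x (log x)^{z−1}‖ ≤ C x (log x)^{Re z − 2}`, `C = desmoothConst C₁ D R N`
(difference quotient with `h = x (log x)^{−2R−1}`, two mean-value steps, and the second difference
of `B₁` through the monotonicity of `B`). [cite: Tenenbaum2015, II.5 §5.4]
[cite: MontgomeryVaughan2007, §7.4 Theorems 7.17–7.18] -/
theorem norm_summatory_sub_le {a : ℕ → ℂ} {b : ℕ → ℝ} (hab : ∀ n, ‖a n‖ ≤ b n) (hb : ∀ n, 0 ≤ b n)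
    {z : ℂ} {R : ℝ} (hz : ‖z‖ ≤ R) {N : ℕ} (hN1 : 1 ≤ N) (hN : 4 * R + 2 ≤ N)
    {c cR : ℕ → ℂ} {D : ℝ} (hc : ∀ k < N, ‖c k‖ ≤ D) (hcR : ∀ k < N, ‖cR k‖ ≤ D)
    {C₁ x₀ : ℝ} (hx₀ : 1 < x₀) (hC₁ : 0 ≤ C₁)
    (hA : ∀ y, x₀ ≤ y → ‖rieszMeanC a y - expansion c z N y‖ ≤
      C₁ * y ^ 2 * Real.log y ^ (z.re - 1 - N))
    (hB : ∀ y, x₀ ≤ y → ‖rieszMeanC (fun n ↦ (b n : ℂ)) y - expansion cR R N y‖ ≤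
      C₁ * y ^ 2 * Real.log y ^ (R - 1 - N))
    {x : ℝ} (hx : 2 * x₀ ≤ x) (hxe : Real.exp 4 ≤ x) :
    ‖summatory a x - 2 * c 0 * x * clog x ^ (z - 1)‖ ≤
      desmoothConst C₁ D R N * x * Real.log x ^ (z.re - 2) := by
  -- basic quantities
  have hR : 0 ≤ R := (norm_nonneg _).trans hz
  have hD : 0 ≤ D := (norm_nonneg _).trans (hc 0 (by omega))
  have hx0 : 0 < x := by linarith
  set ℓ : ℝ := Real.log x with hℓdef
  have hℓ4 : 4 ≤ ℓ := by rw [hℓdef, ← Real.log_exp 4]; exact Real.log_le_log (Real.exp_pos 4) hxe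
  have hℓ1 : 1 ≤ ℓ := by linarith
  have hℓ0 : 0 < ℓ := by linarith
  have hlog2 : Real.log 2 < 1 := by
    have := Real.log_two_lt_d9; linarith
  have hℓ22 : 2 * Real.log 2 ≤ ℓ := by linarith
  set K₀ : ℝ := 2 * R + 1 with hK₀
  have hK₀1 : 1 ≤ K₀ := by linarith
  set h : ℝ := x * ℓ ^ (-K₀) with hhdef
  have hℓK : 4 ≤ ℓ ^ K₀ := le_trans hℓ4 (by
    calc ℓ = ℓ ^ (1 : ℝ) := (Real.rpow_one ℓ).symm
      _ ≤ ℓ ^ K₀ := Real.rpow_le_rpow_of_exponent_le hℓ1 hK₀1)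
  have hh0 : 0 < h := by positivity
  have hh4 : h ≤ x / 4 := by
    rw [hhdef, Real.rpow_neg hℓ0.le, le_div_iff₀ (by norm_num : (0:ℝ) < 4)]
    have : x * (ℓ ^ K₀)⁻¹ * ℓ ^ K₀ = x := by field_simp
    nlinarith [inv_pos.2 (lt_of_lt_of_le (by norm_num) hℓK)]
  have hexp4 : Real.exp 1 * 2 < Real.exp 4 := by
    have h1 : Real.exp 1 < 3 := by have := Real.exp_one_lt_d9; linarith
    have h2 : (16 : ℝ) < Real.exp 4 := by
      have h3 : Real.exp 4 = Real.exp 1 ^ 4 := by rw [← Real.exp_nat_mul]; norm_num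
      have h27 : (2.7 : ℝ) < Real.exp 1 := by have := Real.exp_one_gt_d9; linarith
      have h4 : (2.7 : ℝ) ^ 4 < Real.exp 1 ^ 4 := pow_lt_pow_left₀ h27 (by norm_num) (by norm_num)
      have h5 : (16 : ℝ) < (2.7 : ℝ) ^ 4 := by norm_num
      rw [h3]; linarith
    linarith
  -- points in `[x/2, 2x]`, `≥ x₀`, `≥ e`
  have hmem : ∀ y : ℝ, x - h ≤ y → y ≤ x + 2 * h → (x / 2 ≤ y ∧ y ≤ 2 * x) ∧ x₀ ≤ y ∧ Real.exp 1 ≤ y := by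
    intro y hy1 hy2
    refine ⟨⟨by linarith, by linarith⟩, by linarith, by linarith⟩
  set P : ℝ := R + N + 2 with hPdef
  have hpowcmp : ∀ y e : ℝ, x - h ≤ y → y ≤ x + 2 * h → |e| ≤ P →
      Real.log y ^ e ≤ 2 ^ P * ℓ ^ e := fun y e hy1 hy2 he ↦
    rpow_log_le hx0 hℓ22 (hmem y hy1 hy2).1 he
  have hzre : |z.re| ≤ R := (abs_re_le_norm z).trans hz
  -- Step A: the short sum
  have hEA := norm_rieszMeanC_sub_sub_le hab hx0.le (show x ≤ x + h by linarith)
  rw [show x + h - x = h by ring] at hEA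
  -- Step B: the second difference of `B₁`
  have hmono := mul_sub_summatory_le hb hh0.le (show 0 ≤ x - h by linarith)
  set S₂ : ℝ := N * (D * (2 + 3 * (R + N + 1) + (R + N + 1) * (R + N + 1 + 1))) with hS₂
  have hS₂0 : 0 ≤ S₂ := by positivity
  have hg'' : ∀ t ∈ Icc (x - h) (x + 2 * h), ‖expansion'' cR R N t‖ ≤ S₂ * (2 ^ P * ℓ ^ (R - 1)) := by
    intro t ht
    obtain ⟨-, -, hte⟩ := hmem t ht.1 ht.2
    have h1 := norm_expansion''_le hcR (z := (R : ℂ)) (by rw [Complex.norm_real, Real.norm_of_nonneg hR]) hte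
    simp only [ofReal_re] at h1
    refine h1.trans (mul_le_mul_of_nonneg_left (hpowcmp t (R - 1) ht.1 ht.2 ?_) hS₂0)
    rw [abs_le]; constructor <;> linarith
  have hG2 := norm_second_difference_le hh0.le
    (fun t ht ↦ hasDerivAt_expansion cR R N (lt_of_lt_of_le hx₀ (hmem t ht.1 ht.2).2.1))
    (fun t ht ↦ hasDerivAt_expansion' cR R N (lt_of_lt_of_le hx₀ (hmem t ht.1 ht.2).2.1)) hg''
  have hBerr : ∀ y : ℝ, x - h ≤ y → y ≤ x + 2 * h →
      ‖rieszMeanC (fun n ↦ (b n : ℂ)) y - expansion cR R N y‖ ≤ C₁ * (4 * x ^ 2) * (2 ^ P * ℓ ^ (R - 1 - N)) := by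
    intro y hy1 hy2
    obtain ⟨⟨hy3, hy4⟩, hy0, -⟩ := hmem y hy1 hy2
    refine (hB y hy0).trans ?_
    have hysq : y ^ 2 ≤ 4 * x ^ 2 := by nlinarith
    have hpw := hpowcmp y (R - 1 - N) hy1 hy2 (by rw [abs_le]; constructor <;> linarith)
    exact mul_le_mul (mul_le_mul_of_nonneg_left hysq hC₁) hpw (Real.rpow_nonneg
      (Real.log_nonneg (by linarith)) _) (by positivity)
  have hBdiff : h * ((∑ n ∈ Finset.Ioc 0 ⌊x + h⌋₊, b n) - ∑ n ∈ Finset.Ioc 0 ⌊x⌋₊, b n) ≤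
      4 * (C₁ * (4 * x ^ 2) * (2 ^ P * ℓ ^ (R - 1 - N))) + 2 * h ^ 2 * (S₂ * (2 ^ P * ℓ ^ (R - 1))) := by
    refine hmono.trans ((re_le_norm _).trans ?_)
    set g := expansion cR R N
    set rM := rieszMeanC (fun n ↦ (b n : ℂ))
    have e : rM (x + 2 * h) - rM (x + h) - rM x + rM (x - h) =
        ((rM (x + 2 * h) - g (x + 2 * h)) - (rM (x + h) - g (x + h)) - (rM x - g x) + (rM (x - h) - g (x - h))) +
          (g (x + 2 * h) - g (x + h) - g x + g (x - h)) := by ring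
    rw [e]
    have h1 := hBerr (x + 2 * h) (by linarith) le_rfl
    have h2 := hBerr (x + h) (by linarith) (by linarith)
    have h3 := hBerr x (by linarith) (by linarith)
    have h4 := hBerr (x - h) le_rfl (by linarith)
    calc _ ≤ ‖(rM (x + 2 * h) - g (x + 2 * h)) - (rM (x + h) - g (x + h)) - (rM x - g x) +
          (rM (x - h) - g (x - h))‖ + ‖g (x + 2 * h) - g (x + h) - g x + g (x - h)‖ := norm_add_le _ _
      _ ≤ (‖rM (x + 2 * h) - g (x + 2 * h)‖ + ‖rM (x + h) - g (x + h)‖ + ‖rM x - g x‖ +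
          ‖rM (x - h) - g (x - h)‖) + ‖g (x + 2 * h) - g (x + h) - g x + g (x - h)‖ := by
          gcongr
          exact norm_add_le_of_le (norm_sub_le_of_le (norm_sub_le _ _) le_rfl) le_rfl
      _ ≤ _ := by linarith [h1, h2, h3, h4, hG2]
  -- Step C: the expansions of `A₁` at `x` and `x + h`
  have hEF : ‖(rieszMeanC a (x + h) - expansion c z N (x + h)) - (rieszMeanC a x - expansion c z N x)‖ ≤
      5 * (C₁ * x ^ 2 * (2 ^ P * ℓ ^ (z.re - 1 - N))) := by
    have hEz : |z.re - 1 - N| ≤ P := by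
      rw [abs_le]; constructor <;> linarith [(abs_le.1 hzre).1, (abs_le.1 hzre).2]
    have h1 : ‖rieszMeanC a (x + h) - expansion c z N (x + h)‖ ≤ 4 * (C₁ * x ^ 2 * (2 ^ P * ℓ ^ (z.re - 1 - N))) := by
      refine (hA (x + h) (by linarith)).trans ?_
      have hysq : (x + h) ^ 2 ≤ 4 * x ^ 2 := by nlinarith
      have hpw := hpowcmp (x + h) (z.re - 1 - N) (by linarith) (by linarith) hEz
      calc C₁ * (x + h) ^ 2 * Real.log (x + h) ^ (z.re - 1 - N)
          ≤ C₁ * (4 * x ^ 2) * (2 ^ P * ℓ ^ (z.re - 1 - N)) :=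
            mul_le_mul (mul_le_mul_of_nonneg_left hysq hC₁) hpw
              (Real.rpow_nonneg (Real.log_nonneg (by linarith)) _) (by positivity)
        _ = _ := by ring
    have h2 : ‖rieszMeanC a x - expansion c z N x‖ ≤ C₁ * x ^ 2 * (2 ^ P * ℓ ^ (z.re - 1 - N)) := by
      refine (hA x (by linarith)).trans ?_
      rw [← hℓdef]
      refine mul_le_mul_of_nonneg_left ?_ (by positivity)
      have h2P : (1 : ℝ) ≤ 2 ^ P := Real.one_le_rpow one_le_two (by rw [hPdef]; positivity)
      have hℓe : 0 ≤ ℓ ^ (z.re - 1 - N) := (Real.rpow_pos_of_pos hℓ0 _).le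
      calc ℓ ^ (z.re - 1 - N) = 1 * ℓ ^ (z.re - 1 - N) := (one_mul _).symm
        _ ≤ 2 ^ P * ℓ ^ (z.re - 1 - N) := mul_le_mul_of_nonneg_right h2P hℓe
    calc _ ≤ ‖rieszMeanC a (x + h) - expansion c z N (x + h)‖ + ‖rieszMeanC a x - expansion c z N x‖ :=
          norm_sub_le _ _
      _ ≤ _ := by linarith
  -- Step D: Taylor step for `f`
  have hf'' : ∀ t ∈ Icc x (x + h), ‖expansion'' c z N t‖ ≤ S₂ * (2 ^ P * ℓ ^ (z.re - 1)) := by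
    intro t ht
    obtain ⟨-, -, hte⟩ := hmem t (by linarith [ht.1]) (by linarith [ht.2])
    have h1 := norm_expansion''_le hc hz hte
    refine h1.trans (mul_le_mul_of_nonneg_left (hpowcmp t (z.re - 1) (by linarith [ht.1])
      (by linarith [ht.2]) ?_) hS₂0)
    rw [abs_le]; constructor <;> linarith [(abs_le.1 hzre).1, (abs_le.1 hzre).2]
  have hET := norm_sub_sub_mul_le hh0.le
    (fun t ht ↦ hasDerivAt_expansion c z N (by linarith [ht.1, hmem x (by linarith) (by linarith)]))
    (fun t ht ↦ hasDerivAt_expansion' c z N (by linarith [ht.1, hmem x (by linarith) (by linarith)])) hf''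
  -- Step E: the derivative
  have hED := norm_expansion'_sub_le hc hz hN1 (hmem x (by linarith) (by linarith)).2.2
  rw [← hℓdef] at hED
  -- the algebraic identity
  have hhC : (h : ℂ) ≠ 0 := ofReal_ne_zero.2 hh0.ne'
  set S := summatory a x
  set f := expansion c z N
  set rA := rieszMeanC a
  set M : ℂ := 2 * c 0 * x * clog x ^ (z - 1)
  have key : S - M = (expansion' c z N x - M) +
      ((f (x + h) - f x - h * expansion' c z N x) +
        ((rA (x + h) - f (x + h)) - (rA x - f x)) - (rA (x + h) - rA x - (h : ℂ) * S)) / h := by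
    field_simp; ring
  rw [key]
  -- final bound
  have hℓmono : ∀ {e e' : ℝ}, e ≤ e' → ℓ ^ e ≤ ℓ ^ e' := fun hee ↦ Real.rpow_le_rpow_of_exponent_le hℓ1 hee
  set Q : ℝ := x * ℓ ^ (z.re - 2) with hQ
  have hQ0 : 0 ≤ Q := by positivity
  have hzre' := (abs_le.1 hzre)
  -- `h ℓ^{Re z -1} ≤ Q`, `x² ℓ^{E_z}/h ≤ Q`, `x² ℓ^{E_R}/h ≤ Q`, `h ℓ^{R-1} ≤ Q`
  have hhpow : ∀ e : ℝ, h * ℓ ^ e = x * ℓ ^ (e - K₀) := fun e ↦ by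
    rw [hhdef, mul_assoc, ← Real.rpow_add hℓ0]; ring_nf
  have hhdiv : ∀ e : ℝ, x ^ 2 * ℓ ^ e / h = x * ℓ ^ (e + K₀) := fun e ↦ by
    rw [hhdef, Real.rpow_add hℓ0, Real.rpow_neg hℓ0.le]
    have : ℓ ^ K₀ ≠ 0 := (Real.rpow_pos_of_pos hℓ0 K₀).ne'
    field_simp
  have hb1 : h * ℓ ^ (z.re - 1) ≤ Q := by rw [hhpow]; exact mul_le_mul_of_nonneg_left (hℓmono (by linarith)) hx0.le
  have hb2 : x ^ 2 * ℓ ^ (z.re - 1 - N) / h ≤ Q := by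
    rw [hhdiv]; exact mul_le_mul_of_nonneg_left (hℓmono (by rw [hK₀]; linarith)) hx0.le
  have hb3 : x ^ 2 * ℓ ^ (R - 1 - N) / h ≤ Q := by
    rw [hhdiv]; exact mul_le_mul_of_nonneg_left (hℓmono (by rw [hK₀]; linarith)) hx0.le
  have hb4 : h * ℓ ^ (R - 1) ≤ Q := by
    rw [hhpow]; exact mul_le_mul_of_nonneg_left (hℓmono (by rw [hK₀]; linarith)) hx0.le
  -- norms of the pieces divided by `h`
  have hP0 : 0 ≤ (2 : ℝ) ^ P := by positivity
  have hpart1 : ‖f (x + h) - f x - h * expansion' c z N x‖ / h ≤ S₂ * 2 ^ P * Q := by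
    rw [div_le_iff₀ hh0]
    calc _ ≤ h ^ 2 * (S₂ * (2 ^ P * ℓ ^ (z.re - 1))) := hET
      _ = S₂ * 2 ^ P * (h * ℓ ^ (z.re - 1)) * h := by ring
      _ ≤ S₂ * 2 ^ P * Q * h := by gcongr
  have hpart2 : ‖(rA (x + h) - f (x + h)) - (rA x - f x)‖ / h ≤ 5 * C₁ * 2 ^ P * Q := by
    rw [div_le_iff₀ hh0]
    have := hb2
    rw [div_le_iff₀ hh0] at this
    calc _ ≤ 5 * (C₁ * x ^ 2 * (2 ^ P * ℓ ^ (z.re - 1 - N))) := hEF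
      _ = 5 * C₁ * 2 ^ P * (x ^ 2 * ℓ ^ (z.re - 1 - N)) := by ring
      _ ≤ 5 * C₁ * 2 ^ P * (Q * h) := by gcongr
      _ = _ := by ring
  have hpart3 : ‖rA (x + h) - rA x - (h : ℂ) * S‖ / h ≤ 16 * C₁ * 2 ^ P * Q + 2 * S₂ * 2 ^ P * Q := by
    rw [div_le_iff₀ hh0]
    have hb3' := hb3
    rw [div_le_iff₀ hh0] at hb3'
    have hsum0 : 0 ≤ (∑ n ∈ Finset.Ioc 0 ⌊x + h⌋₊, b n) - ∑ n ∈ Finset.Ioc 0 ⌊x⌋₊, b n :=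
      sub_nonneg.2 (RieszMean.sum_Ioc_floor_mono hb (by linarith))
    calc ‖rA (x + h) - rA x - (h : ℂ) * S‖ ≤ h * ((∑ n ∈ Finset.Ioc 0 ⌊x + h⌋₊, b n) - ∑ n ∈ Finset.Ioc 0 ⌊x⌋₊, b n) := hEA
      _ ≤ 4 * (C₁ * (4 * x ^ 2) * (2 ^ P * ℓ ^ (R - 1 - N))) + 2 * h ^ 2 * (S₂ * (2 ^ P * ℓ ^ (R - 1))) := hBdiff
      _ = 16 * C₁ * 2 ^ P * (x ^ 2 * ℓ ^ (R - 1 - N)) + 2 * S₂ * 2 ^ P * (h * ℓ ^ (R - 1)) * h := by ring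
      _ ≤ 16 * C₁ * 2 ^ P * (Q * h) + 2 * S₂ * 2 ^ P * Q * h := by gcongr
      _ = _ := by ring
  have htri : ‖(expansion' c z N x - M) +
      ((f (x + h) - f x - h * expansion' c z N x) +
        ((rA (x + h) - f (x + h)) - (rA x - f x)) - (rA (x + h) - rA x - (h : ℂ) * S)) / h‖ ≤
      ‖expansion' c z N x - M‖ + (‖f (x + h) - f x - h * expansion' c z N x‖ / h +
        ‖(rA (x + h) - f (x + h)) - (rA x - f x)‖ / h + ‖rA (x + h) - rA x - (h : ℂ) * S‖ / h) := by
    refine (norm_add_le _ _).trans (add_le_add le_rfl ?_)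
    rw [norm_div, Complex.norm_real, Real.norm_of_nonneg hh0.le, ← add_div, ← add_div]
    refine div_le_div_of_nonneg_right ?_ hh0.le
    exact (norm_sub_le _ _).trans (add_le_add (norm_add_le _ _) le_rfl)
  refine htri.trans ?_
  have hEDQ : ‖expansion' c z N x - M‖ ≤ D * ((R + 1) + N * (2 + (R + N + 1))) * Q := by
    rw [hQ, ← mul_assoc]; exact hED
  calc _ ≤ D * ((R + 1) + N * (2 + (R + N + 1))) * Q +
        (S₂ * 2 ^ P * Q + 5 * C₁ * 2 ^ P * Q + (16 * C₁ * 2 ^ P * Q + 2 * S₂ * 2 ^ P * Q)) :=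
        add_le_add hEDQ (add_le_add (add_le_add hpart1 hpart2) hpart3)
    _ = desmoothConst C₁ D R N * x * ℓ ^ (z.re - 2) := by
        rw [desmoothConst, hQ, hS₂, hPdef]; ring

/-! ### The bounded range `2 ≤ x ≤ X₁` and the crude bounds -/

/-- `2^{Ω(n)} ≤ n` for `n ≠ 0`. [folklore] -/
theorem two_pow_cardFactors_le {n : ℕ} (hn : n ≠ 0) : 2 ^ Ω n ≤ n := by
  rw [ArithmeticFunction.cardFactors_apply]
  calc 2 ^ n.primeFactorsList.length ≤ n.primeFactorsList.prod :=
        List.pow_card_le_prod _ _ fun p hp ↦ (Nat.prime_of_mem_primeFactorsList hp).two_le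
    _ = n := Nat.prod_primeFactorsList hn

/-- **Crude bound for the summatory function**: `‖Σ_{n ≤ x} z^{Ω(n)}‖ ≤ x²` for `‖z‖ ≤ 2`, `x ≥ 0`.
[folklore] -/
theorem norm_sum_bigOmegaCoeff_le {z : ℂ} (hz : ‖z‖ ≤ 2) {x : ℝ} (hx : 0 ≤ x) :
    ‖∑ n ∈ Finset.Icc 1 ⌊x⌋₊, bigOmegaCoeff z n‖ ≤ x ^ 2 := by
  have hterm : ∀ n ∈ Finset.Icc 1 ⌊x⌋₊, ‖bigOmegaCoeff z n‖ ≤ x := by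
    intro n hn
    rw [Finset.mem_Icc] at hn
    have hn0 : n ≠ 0 := by omega
    have hnx : (n : ℝ) ≤ x := (Nat.cast_le.2 hn.2).trans (Nat.floor_le hx)
    calc ‖bigOmegaCoeff z n‖ ≤ 2 ^ Ω n := norm_bigOmegaCoeff_le hz n
      _ ≤ n := by exact_mod_cast two_pow_cardFactors_le hn0
      _ ≤ x := hnx
  calc ‖∑ n ∈ Finset.Icc 1 ⌊x⌋₊, bigOmegaCoeff z n‖ ≤ ∑ n ∈ Finset.Icc 1 ⌊x⌋₊, x :=
        norm_sum_le_of_le _ hterm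
    _ = ⌊x⌋₊ * x := by rw [Finset.sum_const, Nat.card_Icc, nsmul_eq_mul]; simp
    _ ≤ x * x := mul_le_mul_of_nonneg_right (Nat.floor_le hx) hx
    _ = x ^ 2 := (sq x).symm

/-- `Finset.Icc 1 n = Finset.Ioc 0 n` in `ℕ`. [folklore] -/
theorem Icc_one_eq_Ioc_zero (n : ℕ) : Finset.Icc 1 n = Finset.Ioc 0 n := by
  ext m; simp [Finset.mem_Icc, Finset.mem_Ioc]; omega

/-- The lower bound `(log x)^{Re z − 2} ≥ min(1, (log X₁)^{−R−2})` for `2 ≤ x ≤ X₁`, `|Re z| ≤ R`.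
[folklore] -/
theorem rpow_log_ge_min {x X₁ R e : ℝ} (hx : 2 ≤ x) (hxX : x ≤ X₁) (he : -R - 2 ≤ e) (he0 : e ≤ 0) :
    min 1 (Real.log X₁ ^ (-R - 2)) ≤ Real.log x ^ e := by
  have hℓ0 : 0 < Real.log x := Real.log_pos (by linarith)
  rcases le_or_gt (Real.log x) 1 with h1 | h1
  · exact (min_le_left _ _).trans (Real.one_le_rpow_of_pos_of_le_one_of_nonpos hℓ0 h1 he0)
  · refine (min_le_right _ _).trans ?_
    have hX : Real.log x ≤ Real.log X₁ := Real.log_le_log (by linarith) hxX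
    calc Real.log X₁ ^ (-R - 2) ≤ Real.log x ^ (-R - 2) :=
          Real.rpow_le_rpow_of_nonpos hℓ0 hX (by linarith)
      _ ≤ Real.log x ^ e := Real.rpow_le_rpow_of_exponent_le h1.le he

/-! ### The theorem -/

/-- A uniform bound for `Γ(w)⁻¹` on `‖w‖ ≤ S` (`1/Γ` is entire). [folklore] -/
theorem exists_norm_inv_Gamma_le (S : ℝ) :
    ∃ Γm : ℝ, 0 ≤ Γm ∧ ∀ w : ℂ, ‖w‖ ≤ S → ‖(Complex.Gamma w)⁻¹‖ ≤ Γm := by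
  obtain ⟨Γm, hΓm⟩ := (isCompact_closedBall (0 : ℂ) S).exists_bound_of_continuousOn
    (Complex.differentiable_one_div_Gamma.continuous.continuousOn)
  refine ⟨max Γm 0, le_max_right _ _, fun w hw ↦ (hΓm w (by simpa using hw)).trans (le_max_left _ _)⟩

end SelbergDelangeOmega

open SelbergDelangeOmega SelbergDelange in
open scoped ArithmeticFunction.Omega in
set_option maxHeartbeats 1600000 in
/-- **The Selberg–Delange law for `z^{Ω(n)}`, PROVED** (discharge of
`Literature.NumberTheory.LFunctions.MontgomeryVaughan2007_thm_7_18_Omega`; Montgomery–Vaughan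
Theorem 7.18 with the Euler product (7.60), `R < 2`; Selberg 1954): for every `R < 2` there is `C`
with `|Σ_{1 ≤ n ≤ x} z^{Ω(n)} − F(1,z) Γ(z)⁻¹ x (log x)^{z−1}| ≤ C x (log x)^{Re z − 2}` for all real
`x ≥ 2` and all `|z| ≤ R`. Proof: the engine `SelbergDelange.exists_riesz_expansion` for the Riesz
means of `z^{Ω(n)}` and of the majorant `R^{Ω(n)}` (`rieszData_bigOmega`), de-smoothing
(`norm_summatory_sub_le`), `2 coeff₀ = F(1,z)` (`coeff_zero`, `bigOmegaF_one`), and crude bounds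
for `2 ≤ x ≤ X₁`. [cite: MontgomeryVaughan2007, §7.4 Theorem 7.18 and (7.60)]
[cite: Tenenbaum2015, II.5 Theorem 5.2 and II.6 Theorem 6.1] -/
theorem MontgomeryVaughan2007_thm_7_18_Omega_holds : MontgomeryVaughan2007_thm_7_18_Omega := by
  intro R hR2
  rcases lt_or_ge R 0 with hRneg | hR0
  · exact ⟨0, fun x _ z hz ↦ absurd (hz.trans_lt hRneg) (not_lt.2 (norm_nonneg z))⟩
  -- the data and the engine
  obtain ⟨B, hB, hdata⟩ := rieszData_bigOmega hR0 hR2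
  have hσ₁ : sigma0 R < 1 := sigma0_lt_one hR2
  set N : ℕ := 4 * ⌈R⌉₊ + 2 with hNdef
  have hRceil : R ≤ ⌈R⌉₊ := Nat.le_ceil R
  have hN : 4 * R + 2 ≤ (N : ℝ) := by rw [hNdef]; push_cast; linarith
  have hN1 : 1 ≤ N := by omega
  have hRN : R ≤ (N : ℝ) := by linarith
  obtain ⟨C₁, x₀, hx₀, hexp⟩ := exists_riesz_expansion R (sigma0 R) B hR0 hσ₁ N hRN
  -- uniform bounds for the coefficients
  obtain ⟨Cn, hCn0, hCn⟩ := exists_norm_exp_mul_logZeta₁_le R hR0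
  obtain ⟨hρ, -, hρ4⟩ := rho_pos hσ₁
  obtain ⟨Γm, hΓm0, hΓm⟩ := exists_norm_inv_Gamma_le (R + N)
  set M : ℝ := Cn * B * 2 with hMdef
  set D : ℝ := M * (2 / rho (sigma0 R)) ^ N * Γm with hDdef
  have hM0 : 0 ≤ M := by positivity
  have h2ρ : 1 ≤ 2 / rho (sigma0 R) := by rw [le_div_iff₀ hρ]; linarith
  have hcoef : ∀ z : ℂ, ‖z‖ ≤ R → ∀ k < N,
      ‖coeff z (fun s ↦ bigOmegaF s z) k * (Complex.Gamma (z - k))⁻¹‖ ≤ D := by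
    intro z hz k hk
    have hd := hdata z hz
    have h1 := norm_coeff_le hρ (differentiableOn_smoothPart hd hσ₁)
      (fun s hs ↦ norm_smoothPart_le hd hσ₁ hCn hs) k
    have h2 : ‖(Complex.Gamma (z - k))⁻¹‖ ≤ Γm := hΓm _ (by
      calc ‖z - (k : ℂ)‖ ≤ ‖z‖ + ‖(k : ℂ)‖ := norm_sub_le _ _
        _ ≤ R + N := by rw [Complex.norm_natCast]; exact add_le_add hz (by exact_mod_cast hk.le))
    rw [norm_mul, hDdef]
    refine mul_le_mul (h1.trans ?_) h2 (norm_nonneg _) (by positivity)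
    exact mul_le_mul_of_nonneg_left (pow_le_pow_right₀ h2ρ hk.le) hM0
  -- the threshold and the constants
  set X₁ : ℝ := max (2 * x₀) (Real.exp 4) with hX₁def
  have hX₁2 : 2 ≤ X₁ := le_trans (by linarith) (le_max_left _ _)
  set Cbig : ℝ := desmoothConst |C₁| D R N with hCbig
  set m : ℝ := min 1 (Real.log X₁ ^ (-R - 2)) with hmdef
  have hm0 : 0 < m := lt_min one_pos (Real.rpow_pos_of_pos (Real.log_pos (by linarith)) _)
  set Csmall : ℝ := X₁ / m + B * Γm * Real.log X₁ with hCsmall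
  have hlogX₁ : 0 < Real.log X₁ := Real.log_pos (by linarith)
  have hCbig0 : 0 ≤ Cbig := by
    rw [hCbig, desmoothConst]
    have : 0 ≤ D := by positivity
    positivity
  have hCsmall0 : 0 ≤ Csmall := by positivity
  refine ⟨Cbig + Csmall, fun x hx z hz ↦ ?_⟩
  have hx0 : 0 < x := by linarith
  have hzR : ‖z‖ ≤ 2 := hz.trans hR2.le
  have hzre : |z.re| ≤ R := (abs_re_le_norm z).trans hz
  -- the main term is `2 coeff₀ Γ(z)⁻¹ x (log x)^{z-1}`
  have hmainterm : selbergDelangeOmegaF z * (Complex.Gamma z)⁻¹ * (x : ℂ) * ((Real.log x : ℝ) : ℂ) ^ (z - 1) =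
      2 * (coeff z (fun s ↦ bigOmegaF s z) 0 * (Complex.Gamma (z - (0 : ℕ)))⁻¹) * x * clog x ^ (z - 1) := by
    rw [coeff_zero, bigOmegaF_one, clog, Nat.cast_zero, sub_zero]; ring
  have hsumeq : ∑ n ∈ Finset.Icc 1 ⌊x⌋₊, z ^ (Ω n) = summatory (bigOmegaCoeff z) x := by
    rw [summatory, Icc_one_eq_Ioc_zero]; rfl
  rcases le_or_gt X₁ x with hxX | hxX
  · -- large `x`: de-smoothing
    have hmain := norm_summatory_sub_le (a := bigOmegaCoeff z) (b := fun n ↦ R ^ Ω n)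
      (fun n ↦ norm_bigOmegaCoeff_le hz n) (fun n ↦ pow_nonneg hR0 _) hz hN1 hN
      (c := fun k ↦ coeff z (fun s ↦ bigOmegaF s z) k * (Complex.Gamma (z - k))⁻¹)
      (cR := fun k ↦ coeff (R : ℂ) (fun s ↦ bigOmegaF s R) k * (Complex.Gamma (R - k))⁻¹)
      (D := D) (hcoef z hz) (hcoef R (by rw [Complex.norm_real, Real.norm_of_nonneg hR0]))
      (C₁ := |C₁|) (x₀ := x₀) hx₀ (abs_nonneg C₁) ?_ ?_ (x := x)
      ((le_max_left _ _).trans hxX) ((le_max_right _ _).trans hxX)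
    · rw [hsumeq, hmainterm]
      refine hmain.trans ?_
      have : 0 ≤ x * Real.log x ^ (z.re - 2) := by
        have := Real.rpow_nonneg (Real.log_nonneg (by linarith : (1:ℝ) ≤ x)) (z.re - 2); positivity
      nlinarith
    · intro y hy
      have h1 := hexp z (bigOmegaCoeff z) (fun s ↦ bigOmegaF s z) (hdata z hz) y hy
      rw [expansion_eq] at h1
      refine (le_of_eq (by rfl)).trans (h1.trans ?_)
      have : 0 ≤ y ^ 2 * Real.log y ^ (z.re - 1 - N) := by
        have := Real.rpow_nonneg (Real.log_nonneg (by linarith : (1:ℝ) ≤ y)) (z.re - 1 - N); positivity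
      nlinarith [le_abs_self C₁]
    · intro y hy
      have hRnorm : ‖(R : ℂ)‖ ≤ R := by rw [Complex.norm_real, Real.norm_of_nonneg hR0]
      have h1 := hexp R (bigOmegaCoeff R) (fun s ↦ bigOmegaF s R) (hdata R hRnorm) y hy
      rw [expansion_eq] at h1
      have hcoe : rieszMeanC (fun n ↦ ((R ^ Ω n : ℝ) : ℂ)) y = rieszMeanC (bigOmegaCoeff R) y := by
        simp only [rieszMeanC, bigOmegaCoeff_ofReal]
      rw [hcoe]
      refine (le_of_eq (by rfl)).trans (h1.trans ?_)
      simp only [ofReal_re]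
      have : 0 ≤ y ^ 2 * Real.log y ^ (R - 1 - N) := by
        have := Real.rpow_nonneg (Real.log_nonneg (by linarith : (1:ℝ) ≤ y)) (R - 1 - N); positivity
      nlinarith [le_abs_self C₁]
  · -- bounded `x`: crude bounds
    have hA := norm_sum_bigOmegaCoeff_le hzR hx0.le
    have hF : ‖selbergDelangeOmegaF z‖ ≤ B := by
      rw [← bigOmegaF_one]
      exact (hdata z hz).norm_G_le 1 (by simp; linarith [sigma0_lt_one hR2])
    have hΓ : ‖(Complex.Gamma z)⁻¹‖ ≤ Γm := hΓm z (hz.trans (by linarith))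
    have hℓ0 : 0 < Real.log x := Real.log_pos (by linarith)
    have hℓX : Real.log x ≤ Real.log X₁ := Real.log_le_log hx0 hxX.le
    have hpow : min 1 (Real.log X₁ ^ (-R - 2)) ≤ Real.log x ^ (z.re - 2) :=
      rpow_log_ge_min hx hxX.le (by linarith [(abs_le.1 hzre).1]) (by linarith [(abs_le.1 hzre).2])
    rw [← hmdef] at hpow
    have hmain : ‖selbergDelangeOmegaF z * (Complex.Gamma z)⁻¹ * (x : ℂ) * ((Real.log x : ℝ) : ℂ) ^ (z - 1)‖ ≤
        B * Γm * Real.log X₁ * (x * Real.log x ^ (z.re - 2)) := by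
      rw [norm_mul, norm_mul, norm_mul, Complex.norm_real, Real.norm_of_nonneg hx0.le,
        norm_cpow_eq_rpow_re_of_pos hℓ0, sub_re, one_re]
      have hsplit : Real.log x ^ (z.re - 1) = Real.log x ^ (z.re - 2) * Real.log x := by
        rw [show z.re - 1 = (z.re - 2) + 1 by ring, Real.rpow_add hℓ0, Real.rpow_one]
      rw [hsplit]
      have hpow0 : 0 ≤ Real.log x ^ (z.re - 2) := (Real.rpow_pos_of_pos hℓ0 _).le
      calc ‖selbergDelangeOmegaF z‖ * ‖(Complex.Gamma z)⁻¹‖ * x * (Real.log x ^ (z.re - 2) * Real.log x)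
          ≤ B * Γm * x * (Real.log x ^ (z.re - 2) * Real.log X₁) := by
            gcongr
        _ = _ := by ring
    have hsum : ‖∑ n ∈ Finset.Icc 1 ⌊x⌋₊, z ^ (Ω n)‖ ≤ X₁ / m * (x * Real.log x ^ (z.re - 2)) := by
      have h1 : ‖∑ n ∈ Finset.Icc 1 ⌊x⌋₊, z ^ (Ω n)‖ ≤ x ^ 2 := hA
      have h2 : x ^ 2 ≤ X₁ * x := by nlinarith
      have h3 : X₁ * x = X₁ / m * (x * m) := by field_simp
      calc _ ≤ X₁ * x := h1.trans h2
        _ = X₁ / m * (x * m) := h3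
        _ ≤ X₁ / m * (x * Real.log x ^ (z.re - 2)) := by
            refine mul_le_mul_of_nonneg_left (mul_le_mul_of_nonneg_left hpow hx0.le) (by positivity)
    calc ‖(∑ n ∈ Finset.Icc 1 ⌊x⌋₊, z ^ (Ω n)) -
          selbergDelangeOmegaF z * (Complex.Gamma z)⁻¹ * (x : ℂ) * ((Real.log x : ℝ) : ℂ) ^ (z - 1)‖
        ≤ ‖∑ n ∈ Finset.Icc 1 ⌊x⌋₊, z ^ (Ω n)‖ +
          ‖selbergDelangeOmegaF z * (Complex.Gamma z)⁻¹ * (x : ℂ) * ((Real.log x : ℝ) : ℂ) ^ (z - 1)‖ :=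
          norm_sub_le _ _
      _ ≤ X₁ / m * (x * Real.log x ^ (z.re - 2)) + B * Γm * Real.log X₁ * (x * Real.log x ^ (z.re - 2)) :=
          add_le_add hsum hmain
      _ = Csmall * x * Real.log x ^ (z.re - 2) := by rw [hCsmall]; ring
      _ ≤ (Cbig + Csmall) * x * Real.log x ^ (z.re - 2) := by
          have : 0 ≤ x * Real.log x ^ (z.re - 2) := by positivity
          nlinarith

end Literature.NumberTheory.LFunctions
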